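import Summits.BirchSwinnertonDyer.Rank1Residual.Supersingular.SignedRankZero
import Summits.BirchSwinnertonDyer.Rank1Residual.Supersingular.PollackConstantTerm
import Literature.NumberTheory.EllipticCurves.BDKim2013.SignedCharValueRankZero
import Literature.NumberTheory.EllipticCurves.Kobayashi2003.SignedSelmerTorsion
import Literature.NumberTheory.EllipticCurves.LeadingTermPPartEisensteinProofs
import Literature.NumberTheory.EllipticCurves.SupersingularDensitySerreFrobeniusProofs
import Literature.NumberTheory.EllipticCurves.BurungaleSkinnerTianWan2024.SupersingularPPartOPEN
import HarnessLib

/-!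
# Kobayashi's signed main conjecture for `(E, p, ε)` on the REAL objects, its Eisenstein half as the
# TYPED MISSING INPUT of class X6 in analytic rank `0`, and Burungale–Skinner–Tian–Wan Thm. 1.3 as an
# OPEN hypothesis (cell `b2b-bsdres`, supersingular family, prover A = unit `b2b-bsdres-x10b`, gen 4)

HONEST FRAMING (run/shared/lean/b2b/bsd-rank1-residual/, verbatim in every file): the goal of the
cell is to DELETE the COMBINATION-SHAPED residual classes of the Birch–Swinnerton-Dyer formula for
ALL analytic-rank `≤ 1` elliptic curves over `ℚ` — "full BSD formula for every rank `≤ 1` curve in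
class `C`" assembled STRICTLY from published theorems — so that the rank-`≤ 1` remainder becomes
exactly the CONSTRUCTION-SHAPED classes, which are TYPED (missing-input `Prop`s), NOT attempted.
This is not "finishing BSD". Class X6 (`ss(p) ∧ sst ∧ (p ≥ 5 ∨ a_3 = 0)`) stays CONSTRUCTION-SHAPED;
nothing about any curve is asserted; an ANNOUNCED preprint (BSTW arXiv:2409.01350v2) enters ONLY as
an explicitly labelled OPEN hypothesis. The definitions are TYPED MISSING INPUTS (`@[conjecture]`,
our obligations) and bookkeeping vocabulary; the theorems display every published input BY NAME.

## What this file does (tasks (iii)+(iv) of `HOME/b2b-bsdres-x10b/X6-ROUTE.md` §2)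

Gen 3 landed the ± rank-zero chain as a SHAPE (`Supersingular/SignedRankZero.lean`, p206397:
hypothesis structure `SignedDatum = (ξ, L, c)` with (K), (P), (MC↓)). The real objects now exist:
Kobayashi's `Sel^ε(E/ℚ_∞)` and its dual — `Kobayashi2003.SignedSelmerDualData W κ γ ε` (harvest-2,
p207367/p207616/p207761), Kobayashi Thm. 1.2 as `Kobayashi2003.thm12_signedSelmerDual_finite_torsion`
(p208294), B. D. Kim 2013 Cor. 3.15 = (K) as `BDKim2013.cor315_signedCharValue_rankZero` (p208351),
Pollack's `L⁺, L⁻ ∈ Λ` as `pollack_exists_plusMinusPAdicLFunction`, and (P) PROVED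
(`Supersingular/PollackConstantTerm.lean`, p208966: `L⁻(0) = 2[0]⁺_f`, `L⁺(0) = (p−1)[0]⁺_f`).
This file re-targets the chain to them:
* `IsPollackPair f p L⁺ L⁻` (verbatim the body of Pollack's named fact), `kobayashiL ε L⁺ L⁻`
  (KOBAYASHI's labelling, Invent. Math. 152 (2003) p. 7: "our sign of Pollack's `p`-adic
  `L`-function is opposite to that in [18]"; by (3.6) the sign `ε = 1` of the even Selmer group goes
  with the tree's `L⁻`, `ε = −1` with `L⁺`), `kobayashiConst p ε ∈ {2, p−1}`,
  `IsPollackPair.constantCoeff_kobayashiL` ((P) on real objects, proved);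
* `KobayashiMainConjecture W p ε` (`@[conjecture]`): "`Char(Sel^±(E/F_∞)^∨) = (L^±_p(E,X))`" for
  ONE `(E, p, ε)` in the NÉRON normalisation, spelled exactly like the cell's `MazurMainConjecture`;
  `KobayashiLowerDivisibility W p ε` (`@[conjecture]`): its EISENSTEIN half — THE missing input of
  X6 ∩ {r_an = 0}; `BurungaleSkinnerTianWan2024_thm13_OPEN`: Thm. 1.3 of arXiv:2409.01350v2 on these
  objects, `[claim: …, under-review]`, NEVER a theorem (FRESHNESS 2026-08-20: still a preprint);
* `missingLowerBoundAt_of_kobayashiLowerDivisibility`: odd good `p`, `a_p = 0`, `E[p]` irreducible,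
  `L(E,1) ≠ 0`: Kobayashi Thm. 1.2 + Kim Cor. 3.15 + Pollack + modularity + GZK (PUB, by name) +
  `KobayashiLowerDivisibility W p ε` ⇒ `MissingLowerBoundAt W p`; `X6.bsdp_of_…` (+ Wuthrich
  Prop. 21); `X6.bsdp_of_BSTW13_OPEN_of_analyticRank_eq_zero`: the kernel REFEREES BSTW's deduction
  "Thm. 1.3 ⇒ Thm. 1.5 (r = 0)" — granted the announced main conjecture, the rank-0 `p`-part follows
  from published results only. So the rank-0 X6 residue READS `KobayashiLowerDivisibility W p ε` for
  one sign — the supersingular twin of `X10b ⇐ MazurMainConjecture W 3`.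

References: [Kobayashi2003] Def. 1.1, Thm. 1.2, Conjecture (p. 2), §4 (p. 8), Thm. 3.2, (3.6) (p. 7);
[Pollack2003] Thm. 5.6, Cor. 5.11, Prop. 6.18; [BDKim2013] Cor. 3.15; [BurungaleSkinnerTianWan2024]
Thm. 1.3, Rem. 1.4 (PRE); [Wuthrich2014] Prop. 21; [CastellaGrossiSkinner2025] (MC); [Miller2011LMS] Def. 1.1.
-/
set_option autoImplicit false

noncomputable section

open scoped Classical MatrixGroups ModularForm

open CongruenceSubgroup WeierstrassCurve Literature.NumberTheory.EllipticCurves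
  Literature.NumberTheory.EllipticCurves.ModularForms
  Literature.NumberTheory.EllipticCurves.Rank1Residual
  Literature.NumberTheory.EllipticCurves.Rank1Residual.Typed
  Literature.NumberTheory.EllipticCurves.Kobayashi2003 ZpExtension

namespace Summit.BirchSwinnertonDyer.Rank1Residual.Supersingular

/-! ### Pollack pairs and Kobayashi's labelling -/

section PollackPair

variable {N : ℕ} [NeZero N] (f : CuspForm (Gamma0 N) 2) (p : ℕ) [Fact p.Prime]

/-- **A Pollack pair** `(L⁺, L⁻) ∈ Λ²` for the form `f` at `p` (POLLACK's labelling): both non-zero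
and satisfying the Mazur–Tate congruences `θ_n ≡ (−1)^{⌊n/2⌋+1} ω_n^± L^± (mod ω_n)` (`n` odd for
`+`, even for `−`) — VERBATIM the body of the tree's named fact `pollack_exists_plusMinusPAdicLFunction`
after its existential (Pollack 2003 Thm. 5.6, Cor. 5.11, Prop. 6.18; the congruences determine the
pair), so that statements can quantify over "Pollack's `L^±`". A predicate; nothing asserted.
[cite: Pollack2003, Thm. 5.6, Cor. 5.11 and Prop. 6.18 (shape only; nothing asserted)] -/
def IsPollackPair (Lplus Lminus : IwasawaAlgebra p) : Prop :=
  Lplus ≠ 0 ∧ Lminus ≠ 0 ∧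
    (∀ n : ℕ, Odd n →
      IsCongrModOmega p n (mazurTateElement f p n)
        ((-1) ^ (n / 2 + 1) * cyclotomicOmegaPlus p n) Lplus) ∧
    (∀ n : ℕ, Even n →
      IsCongrModOmega p n (mazurTateElement f p n)
        ((-1) ^ (n / 2 + 1) * cyclotomicOmegaMinus p n) Lminus)

variable {f p}

/-- Pollack's theorem produces a Pollack pair: the named fact `pollack_exists_plusMinusPAdicLFunction`
(for `p` odd, `f` the newform of `W`, good reduction at `p`, `a_p = 0`) unfolds to
`∃ L⁺ L⁻, IsPollackPair f p L⁺ L⁻`. [cite: Pollack2003, Thm. 5.6, Cor. 5.11 and Prop. 6.18] -/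
theorem exists_isPollackPair {W : WeierstrassCurve ℚ} [W.IsElliptic] [W.IsGloballyMinimal]
    (h : pollack_exists_plusMinusPAdicLFunction (W := W) (f := f) (p := p)) (hp : p ≠ 2)
    (hf : IsNewformOf W f) (hgood : W.HasGoodReductionAtPrime p) (hap : W.frobeniusTrace p = 0) :
    ∃ Lplus Lminus : IwasawaAlgebra p, IsPollackPair f p Lplus Lminus :=
  h hp hf hgood hap

/-- **Kobayashi's labelling** of the signed `p`-adic `L`-function of the sign `ε` of `Sel^ε`
(`ε = 1` even/plus, `ε = −1` odd/minus, as in `Kobayashi2003.signedSelmerInfty`), picked out of a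
Pollack pair `(L⁺, L⁻)` in POLLACK's labelling: Kobayashi p. 7, "our sign of Pollack's `p`-adic
`L`-function is opposite to that in [18]"; by (3.6) (`L_p^+(E,0) = 2·L(E,1)/Ω_E`,
`L_p^−(E,0) = (p−1)·L(E,1)/Ω_E`) against `constantCoeff_pollackMinus/Plus`, Kobayashi's `L_p^+` (the
one in "`Char X^+ = (L_p^+)`") is the tree's `L⁻` and his `L_p^−` is the tree's `L⁺`.
[cite: Kobayashi2003, Thm. 3.2 and (3.6) (p. 7)] -/
def kobayashiL (ε : ℤˣ) (Lplus Lminus : IwasawaAlgebra p) : IwasawaAlgebra p :=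
  if ε = 1 then Lminus else Lplus

variable (p) in
/-- The interpolation constant of `L^ε_p(E, X)` at the trivial character in Kobayashi's labelling:
`2` for `ε = +`, `p − 1` for `ε = −` ((3.6)). [cite: Kobayashi2003, (3.6) (p. 7)] -/
def kobayashiConst (ε : ℤˣ) : ℕ :=
  if ε = 1 then 2 else p - 1

/-- For odd `p` the interpolation constant `c_ε ∈ {2, p−1}` is prime to `p`. [cite: Kobayashi2003, (3.6) (p. 7)] -/
theorem not_dvd_kobayashiConst (hp : p ≠ 2) (ε : ℤˣ) : ¬ p ∣ kobayashiConst p ε := by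
  have hpP : p.Prime := Fact.out
  have h2 : 2 < p := lt_of_le_of_ne hpP.two_le (Ne.symm hp)
  unfold kobayashiConst
  split_ifs
  · intro h
    exact absurd (Nat.le_of_dvd two_pos h) (by omega)
  · intro h
    have := Nat.le_of_dvd (by omega) h
    omega

/-- **(P) on the real objects, PROVED**: for a Pollack pair of the newform `f` of `W` at an odd good
prime with `a_p = 0`, `L^ε(0) = c_ε · [0]⁺_f` in `ℚ_p` (`[0]⁺_f = L(E,1)/Ω⁺_f`), `c_+ = 2`,
`c_− = p − 1` — Kobayashi (3.6) in the `Ω⁺_f`-normalisation (`constantCoeff_pollackMinus`,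
`constantCoeff_pollackPlus`). [cite: Kobayashi2003, (3.6) (p. 7)] -/
theorem IsPollackPair.constantCoeff_kobayashiL {W : WeierstrassCurve ℚ} [W.IsElliptic]
    [W.IsGloballyMinimal] {Lplus Lminus : IwasawaAlgebra p} (hL : IsPollackPair f p Lplus Lminus)
    (hp : p ≠ 2) (hf : IsNewformOf W f) (hgood : W.HasGoodReductionAtPrime p)
    (hap : W.frobeniusTrace p = 0) (ε : ℤˣ) :
    ((PowerSeries.constantCoeff (kobayashiL ε Lplus Lminus) : ℤ_[p]) : ℚ_[p]) =
      (kobayashiConst p ε : ℚ_[p]) * ((ratPlusSymbol f 0 : ℚ) : ℚ_[p]) := by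
  unfold kobayashiL kobayashiConst
  split_ifs with hε
  · rw [constantCoeff_pollackMinus hp hf hgood hap (hL.2.2.2 0 ⟨0, rfl⟩)]
    push_cast
    ring
  · rw [constantCoeff_pollackPlus hp hf hgood hap (hL.2.2.1 1 odd_one)]
    have h1 : 1 ≤ p := (Fact.out : p.Prime).one_lt.le
    push_cast [Nat.cast_sub h1]
    ring

end PollackPair

section MainConjecture

/-- **TYPED MISSING INPUT — Kobayashi's main conjecture for `(E, p, ε)`, Néron normalisation.**
Kobayashi, Invent. Math. 152 (2003), p. 2: "Conjecture (Main Conjecture). Suppose `a_p = 0` (e.g.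
`p ≥ 5`). Then the characteristic ideal of the Pontryagin dual of `Sel^±(E/F_∞)` is generated by
Pollack's `p`-adic `L`-function `L^±_p(E, X)`: `Char(Sel^±(E/F_∞)^∨) = (L^±_p(E, X))`" (§4, p. 8:
even/odd main conjectures; `F = ℚ`, `F_∞` the cyclotomic `ℤ_p`-extension; Pollack's `L^±_p`
normalised by the Néron period `Ω_E`, (3.4)–(3.6)). Spelled for ONE sign `ε` exactly as the cell's
`MazurMainConjecture W p` (`Rank1ResidualX1Defs`): for a globally minimal `W`, the cyclotomic
`ℤ_p`-extension `κ` with a topological generator `γ` matching the cyclotomic variable of Pollack's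
`θ_n` (`IsCyclotomicVariable`), the newform `f` of `E` at level `N_E`, the rational `ϖ` with
`ϖ · Ω_E = Ω⁺_f` (so that `ϖ · L^ε` is the Néron-normalised function), every Pollack pair
`(L⁺, L⁻)` (`IsPollackPair`, Pollack's labelling; `kobayashiL ε` picks Kobayashi's `L^ε_p`) and every
Pontryagin-dual datum `D` of `Sel^ε(E/ℚ_∞)` (`Kobayashi2003.SignedSelmerDualData`, Def. 1.1):
`X^ε = D.X` is `Λ`-torsion and `char X^ε = (g)` with `ι g = ϖ · ι L^ε` in `ℚ_p⟦T⟧`. OPEN for non-CM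
`E` (Kobayashi Thm. 4.1: `⊇` up to `pⁿ`; Pollack–Rubin 2004: CM; announced for semistable `E`:
`BurungaleSkinnerTianWan2024_thm13_OPEN`). Nothing asserted.
[cite: Kobayashi2003, Conjecture (Main Conjecture) (p. 2) and §4 (p. 8)] -/
@[conjecture] def KobayashiMainConjecture (W : WeierstrassCurve ℚ) [W.IsElliptic]
    [W.IsGloballyMinimal] (p : ℕ) [Fact p.Prime] (ε : ℤˣ) : Prop :=
  ∀ (κ : ZpExtension ℚ p) (γ : Field.absoluteGaloisGroup ℚ),
      κ.IsCyclotomic → κ.IsTopGenerator γ → IsCyclotomicVariable p γ →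
    ∀ [NeZero (W.conductorNorm ℤ)] (f : CuspForm (Gamma0 (W.conductorNorm ℤ)) 2),
      IsNewformOf W f → ∀ (ϖ : ℚ), (ϖ : ℝ) * W.realPeriodRat = plusPeriod f →
    ∀ (Lplus Lminus : IwasawaAlgebra p), IsPollackPair f p Lplus Lminus →
    ∀ (D : SignedSelmerDualData W κ γ ε), Module.IsTorsion (IwasawaAlgebra p) D.X ∧
      ∃ g : IwasawaAlgebra p, D.charIdeal = Ideal.span {g} ∧
        iwasawaToPowerSeries p g =
          PowerSeries.C (ϖ : ℚ_[p]) * iwasawaToPowerSeries p (kobayashiL ε Lplus Lminus)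

/-- **TYPED MISSING INPUT — the Eisenstein half of Kobayashi's main conjecture for `(E, p, ε)`**:
in the setting of `KobayashiMainConjecture W p ε`, the Néron-normalised signed `p`-adic `L`-function
`ϖ · L^ε` DIVIDES a generator of `char X^ε(E/ℚ_∞)` in `Λ`: `char X^ε = (g)` with
`ι g = ϖ · ι(L^ε · h)` for some `h ∈ Λ` (the divisibility that BOUNDS SELMER FROM BELOW). For ONE
sign this is exactly what the rank-`0` `p`-part of BSD on class X6 needs beyond published results
(`missingLowerBoundAt_of_kobayashiLowerDivisibility`); the Kato-side inclusion (Kobayashi Thm. 4.1)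
is not needed there (Wuthrich 2014 Prop. 21). OPEN (announced: BSTW Thm. 1.3, PRE). Nothing asserted.
[cite: Kobayashi2003, Conjecture (Main Conjecture) (p. 2) and Thm. 4.1 (p. 8)] -/
@[conjecture] def KobayashiLowerDivisibility (W : WeierstrassCurve ℚ) [W.IsElliptic]
    [W.IsGloballyMinimal] (p : ℕ) [Fact p.Prime] (ε : ℤˣ) : Prop :=
  ∀ (κ : ZpExtension ℚ p) (γ : Field.absoluteGaloisGroup ℚ),
      κ.IsCyclotomic → κ.IsTopGenerator γ → IsCyclotomicVariable p γ →
    ∀ [NeZero (W.conductorNorm ℤ)] (f : CuspForm (Gamma0 (W.conductorNorm ℤ)) 2),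
      IsNewformOf W f → ∀ (ϖ : ℚ), (ϖ : ℝ) * W.realPeriodRat = plusPeriod f →
    ∀ (Lplus Lminus : IwasawaAlgebra p), IsPollackPair f p Lplus Lminus →
    ∀ (D : SignedSelmerDualData W κ γ ε),
      ∃ g h : IwasawaAlgebra p, D.charIdeal = Ideal.span {g} ∧
        iwasawaToPowerSeries p g =
          PowerSeries.C (ϖ : ℚ_[p]) * iwasawaToPowerSeries p (kobayashiL ε Lplus Lminus * h)

/-- The main conjecture for `(E, p, ε)` implies its Eisenstein half (`h = 1`).
[cite: Kobayashi2003, Conjecture (Main Conjecture) (p. 2)] -/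
theorem kobayashiLowerDivisibility_of_mainConjecture {W : WeierstrassCurve ℚ} [W.IsElliptic]
    [W.IsGloballyMinimal] {p : ℕ} [Fact p.Prime] {ε : ℤˣ} (h : KobayashiMainConjecture W p ε) :
    KobayashiLowerDivisibility W p ε := by
  intro κ γ hκ hγ hγ' _ f hf ϖ hϖ Lplus Lminus hL D
  obtain ⟨_, g, hg, hιg⟩ := h κ γ hκ hγ hγ' f hf ϖ hϖ Lplus Lminus hL D
  exact ⟨g, 1, hg, by rw [mul_one, hιg]⟩

/-- **OPEN HYPOTHESIS — UNREFEREED PREPRINT (Burungale–Skinner–Tian–Wan, arXiv:2409.01350v2),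
Thm. 1.3.** "Let `E/ℚ` be a semistable elliptic curve, and `p > 2` a supersingular prime. If `p = 3`,
suppose that (h4) [`a_3 = 0`] holds. Then Kobayashi's Conjecture (Kob) is true, i.e. for `∘ ∈ {+, −}`,
we have `(𝓛_p^∘(E)) = ξ_Λ(X_∘(E))`" (`X_∘` the `Λ`-adic form of Kobayashi's `Sel^±(E/ℚ_∞)^∨`; signs
"consistent with [Ko]", p. 49; Rem. 1.4 (i): supersedes Wan's withdrawn [W]). Transcribed: `p ≠ 2`,
`Semistable W`, `GoodSS W p`, `p = 3 → a_3 = 0`, every sign `ε` ⇒ `KobayashiMainConjecture W p ε`; the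
twist clause is not included. NEVER cite this `Prop` as a theorem (FRESHNESS 2026-08-20: arXiv v2, no
journal record); take it as an explicit hypothesis. [claim: BurungaleSkinnerTianWan2024, status: under-review] -/
def BurungaleSkinnerTianWan2024_thm13_OPEN : Prop :=
  ∀ (W : WeierstrassCurve ℚ) [W.IsElliptic] [W.IsGloballyMinimal] (p : ℕ) [Fact p.Prime],
    p ≠ 2 → Semistable W → GoodSS W p → (p = 3 → W.frobeniusTrace 3 = 0) →
      ∀ ε : ℤˣ, KobayashiMainConjecture W p ε

end MainConjecture

/-! ### The ± rank-zero chain on the real objects -/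

section Chain

variable (W : WeierstrassCurve ℚ) [W.IsElliptic] [W.IsGloballyMinimal] (p : ℕ) [Fact p.Prime]

/-- On class X6 at an odd prime, `a_p = 0`: for `p ≥ 5` by Hasse (`natCast_dvd_frobeniusTrace_iff_eq_zero`),
for `p = 3` by the class condition `a_3 = 0`. [cite: Serre1981, §8.1–8.2 (pp. 188–189)] -/
theorem ClassX6.frobeniusTrace_eq_zero (hp : p ≠ 2) (hX : ClassX6 W p) :
    W.frobeniusTrace p = 0 := by
  have hpP : p.Prime := Fact.out
  by_cases hp5 : 5 ≤ p
  · exact (W.natCast_dvd_frobeniusTrace_iff_eq_zero p hp5 hX.1.1).mp hX.1.2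
  · have hp3 : p = 3 := by
      have h2 := hpP.two_le
      interval_cases p
      · exact absurd rfl hp
      · rfl
      · exact absurd hpP (by decide)
    subst hp3
    rcases hX.2.2 with h5 | h0
    · omega
    · exact h0

/-- **The ± rank-zero chain on the real objects (lower half).** Let `p` be an odd prime of good
reduction of `E = W` with `a_p = 0`, `E[p]` irreducible (so `p ∤ #E(ℚ)_tors`) and `L(E,1) ≠ 0`.
Granted the PUBLISHED inputs, each by name — Kobayashi 2003 Thm. 1.2 (`h12`: `X^ε` f.g.
`Λ`-torsion), B. D. Kim 2013 Cor. 3.15 (`hKim`: `g(0) ∼ #Sel_{p^∞}(E/ℚ)·∏c_ℓ`), Pollack 2003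
(`hPollack`: a Pollack pair exists), modularity with the period ratio `ϖ` (`hmod`), and
Gross–Zagier–Kolyvagin (`hGZK`: rank `0`, `Ш` finite) — the Eisenstein divisibility
`KobayashiLowerDivisibility W p ε` for ONE sign forces `ord_p #Ш_an ≤ ord_p #Ш`
(`MissingLowerBoundAt W p`). Chain: `ι g = ϖ · ι(L^ε h)` gives `g(0) = c_ε · t · h(0)` with
`t = ϖ·[0]⁺_f = L(E,1)/Ω_E` ((P), PROVED) and `h(0) ∈ ℤ_p`, so `ord_p t ≤ ord_p g(0)` (`p ∤ c_ε`);
Kim with `#Sel_{p^∞}(E/ℚ) = #Ш[p^∞]` (GZK) gives `ord_p g(0) = ord_p ∏c_ℓ + ord_p #Ш` (gen-3 lemma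
`valuation_constantCoeff_xi` on the datum `ξ := g`); then `#Ш_an = t·#tors²/∏c`, `p ∤ #tors`. The
period ratio `ϖ` cancels — no Manin-constant input.
[cite: Kobayashi2003, Thm. 1.2 and (3.6)] [cite: BDKim2013, Cor. 3.15 (p. 199)]
[cite: Pollack2003, Prop. 6.18] [cite: Miller2011LMS, Def. 1.1] -/
theorem missingLowerBoundAt_of_kobayashiLowerDivisibility
    (h12 : Kobayashi2003.thm12_signedSelmerDual_finite_torsion)
    (hKim : BDKim2013.cor315_signedCharValue_rankZero)
    (hPollack : ∀ {N : ℕ} [NeZero N] {f : CuspForm (Gamma0 N) 2},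
      pollack_exists_plusMinusPAdicLFunction (W := W) (f := f) (p := p))
    (hmod : nonempty_modularParametrizationData)
    (hGZK : rank_eq_analyticRank_of_analyticRank_le_one)
    (hp : p ≠ 2) (hgood : W.HasGoodReductionAtPrime p) (hap : W.frobeniusTrace p = 0)
    (hirr : W.HasIrreducibleModPGaloisRep p) (hL : W.entireLFunction 1 ≠ 0)
    {ε : ℤˣ} (hdiv : KobayashiLowerDivisibility W p ε) : MissingLowerBoundAt W p := by
  have hpP : p.Prime := Fact.out
  have hr : W.analyticRank = 0 := analyticRank_eq_zero_of_entireLFunction_one_ne_zero W hL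
  -- modularity: the newform `f` of `E` at level `N_E` and the period ratio `ϖ`
  haveI : NeZero (W.conductorNorm ℤ) := ⟨(W.conductorNorm_pos_holds).ne'⟩
  obtain ⟨Dm⟩ := hmod W
  set f := Dm.f with hf_def
  have hf : IsNewformOf W f := Dm.isNewformOf
  obtain ⟨ϖ, hϖpos, hϖeq, hΩpos⟩ := Dm.exists_rat_mul_realPeriodRat_eq_plusPeriod
  -- `t = ϖ · [0]⁺_f = L(E,1)/Ω_E`
  set s : ℚ := ratPlusSymbol f 0 with hs_def
  set t : ℚ := ϖ * s with ht_def
  have hLval : W.entireLFunction 1 = (((s : ℝ) * plusPeriod f : ℝ) : ℂ) := hf.entireLFunction_one_eq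
  have ht : W.entireLFunction 1 / (W.realPeriodRat : ℂ) = ((t : ℚ) : ℂ) := by
    rw [hLval, ← hϖeq, div_eq_iff (Complex.ofReal_ne_zero.mpr hΩpos.ne'), ht_def]
    push_cast
    ring
  have hs0 : s ≠ 0 := by
    intro h0
    apply hL
    rw [hLval, h0]
    simp
  have ht0 : t ≠ 0 := mul_ne_zero hϖpos.ne' hs0
  -- the cyclotomic setting, a Pollack pair, the signed dual datum
  obtain ⟨κ, hκ, γ, hγ, hγ'⟩ := exists_isCyclotomic_isTopGenerator_isCyclotomicVariable_holds p
  obtain ⟨Lplus, Lminus, hPP⟩ := exists_isPollackPair hPollack hp hf hgood hap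
  obtain ⟨D⟩ := nonempty_signedSelmerDualData W κ ε hγ
  have h12D := h12 W p hp hgood hap κ γ hκ hγ ε D
  -- (MC↓): `char X^ε = (g)`, `ι g = ϖ · ι(L^ε · h)`
  obtain ⟨g, h, hchar, hιg⟩ := hdiv κ γ hκ hγ hγ' f hf ϖ hϖeq Lplus Lminus hPP D
  -- (K): `g(0) ≠ 0` and `ord_p g(0) = ord_p ∏c + ord_p #Ш` (gen-3 lemma on the datum `ξ := g`)
  obtain ⟨hg0ne, hvg⟩ := valuation_constantCoeff_xi W p hGZK hL ⟨g, 0, 0⟩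
    (BDKim2013.cor315_signedCharValue_rankZero.eulerCharacteristic hKim hp hgood hap hκ hγ D h12D
      hchar)
  -- constant terms: `g(0) = ϖ · L^ε(0) · h(0) = c_ε · t · h(0)`
  have hLε := hPP.constantCoeff_kobayashiL hp hf hgood hap ε
  have hg0 : ((PowerSeries.constantCoeff g : ℤ_[p]) : ℚ_[p]) =
      (kobayashiConst p ε : ℚ_[p]) * ((t : ℚ) : ℚ_[p]) *
        ((PowerSeries.constantCoeff h : ℤ_[p]) : ℚ_[p]) := by
    have hc := congrArg PowerSeries.constantCoeff hιg
    rw [constantCoeff_iwasawaToPowerSeries, map_mul, PowerSeries.constantCoeff_C,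
      constantCoeff_iwasawaToPowerSeries, map_mul, PadicInt.coe_mul, hLε] at hc
    rw [hc, ht_def]
    push_cast
    ring
  -- valuations
  have hcne : kobayashiConst p ε ≠ 0 := fun h0 ↦
    not_dvd_kobayashiConst hp ε (by rw [h0]; exact dvd_zero p)
  have hc0 : (kobayashiConst p ε : ℚ_[p]) ≠ 0 := by exact_mod_cast hcne
  have htQ0 : ((t : ℚ) : ℚ_[p]) ≠ 0 := by exact_mod_cast ht0
  have hh0 : ((PowerSeries.constantCoeff h : ℤ_[p]) : ℚ_[p]) ≠ 0 := fun h0 ↦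
    hg0ne (by rw [hg0, h0, mul_zero])
  have hval := congrArg Padic.valuation hg0
  rw [Padic.valuation_mul (mul_ne_zero hc0 htQ0) hh0, Padic.valuation_mul hc0 htQ0,
    Padic.valuation_natCast, padicValNat.eq_zero_of_not_dvd (not_dvd_kobayashiConst hp ε),
    Padic.valuation_ratCast, hvg] at hval
  have hhnn := valuation_coe_padicInt_nonneg _ hh0
  have hmain : padicValRat p t ≤ (padicValNat p W.tamagawaProduct : ℤ) + padicValNat p W.shaOrder := by
    linarith
  refine ⟨t * (W.torsionOrder : ℚ) ^ 2 / (W.tamagawaProduct : ℚ),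
    shaAn_eq_of_analyticRank_eq_zero W hGZK hr ht, ?_⟩
  rw [padicValRat_shaAn_witness W p hirr ht0]
  linarith

/-- **X6 ∩ {r_an = 0}, odd `p`: `BSD(E,p)` from the Eisenstein half of Kobayashi's main conjecture
for ONE sign, every other input PUBLISHED and named**: Wuthrich 2014 Prop. 21 (`hW`; image proviso by
`ClassX6.surj`), Kobayashi Thm. 1.2 (`h12`), Kim Cor. 3.15 (`hKim`), Pollack (`hPollack`), modularity
(`hmod`, `hmod'`), GZK (`hGZK`) + `KobayashiLowerDivisibility W p ε` (OPEN) ⇒ `BSDp W p`; irreducibility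
(`ClassX6.irr`) and `a_p = 0` (`ClassX6.frobeniusTrace_eq_zero`) are automatic.
[cite: Wuthrich2014, Prop. 21 (p. 400)] [cite: Kobayashi2003, Thm. 1.2 and (3.6)]
[cite: BDKim2013, Cor. 3.15 (p. 199)] [cite: Serre1972, §1.11 Prop. 12] [cite: Miller2011LMS, Def. 1.1] -/
theorem X6.bsdp_of_kobayashiLowerDivisibility_of_analyticRank_eq_zero
    (hW : Wuthrich2014.sha_dvd_analyticSha)
    (h12 : Kobayashi2003.thm12_signedSelmerDual_finite_torsion)
    (hKim : BDKim2013.cor315_signedCharValue_rankZero)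
    (hPollack : ∀ {N : ℕ} [NeZero N] {f : CuspForm (Gamma0 N) 2},
      pollack_exists_plusMinusPAdicLFunction (W := W) (f := f) (p := p))
    (hmod : nonempty_modularParametrizationData) (hmod' : hasEntireLFunction_rat)
    (hGZK : rank_eq_analyticRank_of_analyticRank_le_one)
    (hp : p ≠ 2) (hX : ClassX6 W p) (h0 : W.analyticRank = 0)
    {ε : ℤˣ} (hdiv : KobayashiLowerDivisibility W p ε) : BSDp W p := by
  have hL : W.entireLFunction 1 ≠ 0 := (W.analyticRank_eq_zero_iff_holds (hmod' W)).1 h0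
  exact X6.bsdp_of_missingLowerBoundAt_of_analyticRank_eq_zero W p hW hGZK hmod' hp hX h0
    (missingLowerBoundAt_of_kobayashiLowerDivisibility W p h12 hKim hPollack hmod hGZK hp hX.1.1
      (ClassX6.frobeniusTrace_eq_zero W p hp hX) (ClassX6.irr W p hp hX) hL hdiv)

/-- **X6 ∩ {r_an = 0}, odd `p`: `BSD(E,p)` from the main conjecture for `(E, p, ε)`** (only its
Eisenstein half is used). [cite: Kobayashi2003, Conjecture (p. 2)] [cite: Wuthrich2014, Prop. 21 (p. 400)] -/
theorem X6.bsdp_of_kobayashiMainConjecture_of_analyticRank_eq_zero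
    (hW : Wuthrich2014.sha_dvd_analyticSha)
    (h12 : Kobayashi2003.thm12_signedSelmerDual_finite_torsion)
    (hKim : BDKim2013.cor315_signedCharValue_rankZero)
    (hPollack : ∀ {N : ℕ} [NeZero N] {f : CuspForm (Gamma0 N) 2},
      pollack_exists_plusMinusPAdicLFunction (W := W) (f := f) (p := p))
    (hmod : nonempty_modularParametrizationData) (hmod' : hasEntireLFunction_rat)
    (hGZK : rank_eq_analyticRank_of_analyticRank_le_one)
    (hp : p ≠ 2) (hX : ClassX6 W p) (h0 : W.analyticRank = 0)
    {ε : ℤˣ} (hMC : KobayashiMainConjecture W p ε) : BSDp W p :=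
  X6.bsdp_of_kobayashiLowerDivisibility_of_analyticRank_eq_zero W p hW h12 hKim hPollack hmod hmod'
    hGZK hp hX h0 (kobayashiLowerDivisibility_of_mainConjecture hMC)

/-- **The kernel REFEREES "BSTW Thm. 1.3 ⇒ Thm. 1.5 (r = 0)".** IF the announced Thm. 1.3
(`hBSTW13_OPEN`, unrefereed) holds, then at every X6 pair with `p` odd and `ord_{s=1} L(E,s) = 0`,
`BSD(E,p)` follows from PUBLISHED results alone (Wuthrich Prop. 21, Kobayashi Thm. 1.2, Kim Cor. 3.15,
Pollack, modularity, GZK — by name). Compare `X6.bsdp_of_thm15_OPEN'`, which takes Thm. 1.5 itself as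
the OPEN binder. [claim: BurungaleSkinnerTianWan2024, status: under-review] [cite: Wuthrich2014, Prop. 21 (p. 400)] -/
theorem X6.bsdp_of_BSTW13_OPEN_of_analyticRank_eq_zero
    (hBSTW13_OPEN : BurungaleSkinnerTianWan2024_thm13_OPEN)
    (hW : Wuthrich2014.sha_dvd_analyticSha)
    (h12 : Kobayashi2003.thm12_signedSelmerDual_finite_torsion)
    (hKim : BDKim2013.cor315_signedCharValue_rankZero)
    (hPollack : ∀ {N : ℕ} [NeZero N] {f : CuspForm (Gamma0 N) 2},
      pollack_exists_plusMinusPAdicLFunction (W := W) (f := f) (p := p))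
    (hmod : nonempty_modularParametrizationData) (hmod' : hasEntireLFunction_rat)
    (hGZK : rank_eq_analyticRank_of_analyticRank_le_one)
    (hp : p ≠ 2) (hX : ClassX6 W p) (h0 : W.analyticRank = 0) : BSDp W p :=
  X6.bsdp_of_kobayashiMainConjecture_of_analyticRank_eq_zero W p hW h12 hKim hPollack hmod hmod'
    hGZK hp hX h0
    (hBSTW13_OPEN W p hp hX.2.1 hX.1 (BurungaleSkinnerTianWan2024.h4_of_classX6 W p hX) 1)

end Chain

end Summit.BirchSwinnertonDyer.Rank1Residual.Supersingular

end
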